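import Mathlib
import Summits.ValiantsHypothesis.ValiantsHypothesis.Theorems.FifoMatchingNNMonotoneHard
import Literature.NumberTheory.LFunctions.SiegelWalfiszLiouville
import HarnessLib

/-!
# Crux `NNLinearDegreeCofactorHard` (stmt-ValiantsHypothesis-23918), line `internal_cofactor`: the GROWTH condition `hr` of
# `avoidingCounts28_of_pricing` for quarter-root rates (`stub_params`, LEAD p2)

`InternalCofactor.avoidingCounts28_of_pricing (r) (hμ) (hr)` (p602549) turns the μ* pricing with rate `r` into the counts of
`denseInternalHard_of_counts 28`, provided `hr`: for every `c`, eventually in `n`, `8·(2^((log₂ n + c)^c) + 1)·(M+1)²·(3/4)^{r M} < 1`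
whenever `n ≤ 14(M+2)`.  The heart (D*)/U5 gives `tests + passages ≥ const · (C.m)^{1/4}`.  This file discharges `hr` for every such
rate, in the naturals-friendly form `Nat.sqrt (Nat.sqrt M) ≤ C₀·(r M + 1)`:

* (`M < (⌊⌊√M⌋^{1/2}⌋ + 1)^4` is the tree's `Literature.…SiegelWalfiszLiouville.lt_sqrt_sqrt_add_one_pow`); `three_quarters_pow_five_mul_le` — `(3/4)^{5j} ≤ (1/4)^j`;
* `eventually_poly_le_two_pow` — `5C₀((4p+8+c)^c + 8p + 15) + 1 ≤ 2^p` for all large `p`;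
* `hr_of_quarterRoot` — **the growth condition** for every `r` with `Nat.sqrt (Nat.sqrt M) ≤ C₀ (r M + 1)`.

Honest framing: arithmetic (`stub_params`-sized); nothing here proves the pricing, S2b, the crux or VP ≠ VNP.  No definitions,
no named facts.
-/

-- Sub = Summit single-conjunct layout: the duplicated namespace component is mandated by the tree.
set_option linter.dupNamespace false

namespace Summit.ValiantsHypothesis.ValiantsHypothesis.Theorems.FifoMatching.NNLinearDegreeCofactorHard.InternalCofactor

open Finset Filter
open Summit.ValiantsHypothesis.ValiantsHypothesis.Theorems.FifoMatching.NNMonotoneHard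

/-! ### Elementary pieces -/

/-- `2^p ≤ q + 1` for `p = ⌊log₂ (q+1)⌋`… conversely: if `2^(4 p₀) ≤ M` then `2^p₀ ≤ ⌊√⌊√M⌋⌋`. [folklore] -/
theorem two_pow_le_quarterRoot {p₀ M : ℕ} (h : 2 ^ (4 * p₀) ≤ M) : 2 ^ p₀ ≤ Nat.sqrt (Nat.sqrt M) := by
  have h1 : 2 ^ (2 * p₀) ≤ Nat.sqrt M := by
    rw [Nat.le_sqrt]
    calc 2 ^ (2 * p₀) * 2 ^ (2 * p₀) = 2 ^ (4 * p₀) := by rw [← pow_add]; ring_nf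
      _ ≤ M := h
  rw [Nat.le_sqrt]
  calc 2 ^ p₀ * 2 ^ p₀ = 2 ^ (2 * p₀) := by rw [← pow_add]; ring_nf
    _ ≤ Nat.sqrt M := h1

/-- `(3/4)^5 ≤ 1/4`, hence `(3/4)^{5j} ≤ (1/4)^j`. [folklore] -/
theorem three_quarters_pow_five_mul_le (j : ℕ) : (3 / 4 : ℝ) ^ (5 * j) ≤ (1 / 4 : ℝ) ^ j := by
  rw [pow_mul]
  exact pow_le_pow_left₀ (by norm_num) (by norm_num) j

/-- **Polynomial versus exponential**: `5·C₀·((4p + 8 + c)^c + 8p + 15) + 1 ≤ 2^p` for all large `p`. [folklore] -/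
theorem eventually_poly_le_two_pow (c C₀ : ℕ) :
    ∃ p₀ : ℕ, ∀ p : ℕ, p₀ ≤ p → 5 * C₀ * ((4 * p + 8 + c) ^ c + 8 * p + 15) + 1 ≤ 2 ^ p := by
  -- `K (p+1)^(c+1) ≤ 2^p` eventually, with `K := 5 C₀ ((c+9)^c + 15) + 1`
  set K : ℕ := 5 * C₀ * ((c + 9) ^ c + 15) + 1 with hK
  have E := eventually_const_mul_pow_mul_pow_lt (c + 1) (C := ((K * 2 ^ (c + 1) : ℕ) : ℝ)) (a := 1 / 2)
    (by norm_num) (by norm_num) one_pos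
  obtain ⟨p₀, hp₀⟩ := Filter.eventually_atTop.1 ((eventually_ge_atTop 1).and E)
  refine ⟨p₀, fun p hp => ?_⟩
  obtain ⟨hp1, hE⟩ := hp₀ p hp
  -- crude polynomial bounds in `ℕ`
  have h1 : 4 * p + 8 + c ≤ (c + 9) * (p + 1) := by nlinarith
  have h2 : (4 * p + 8 + c) ^ c ≤ (c + 9) ^ c * (p + 1) ^ c := by
    calc (4 * p + 8 + c) ^ c ≤ ((c + 9) * (p + 1)) ^ c := Nat.pow_le_pow_left h1 c
      _ = (c + 9) ^ c * (p + 1) ^ c := mul_pow _ _ _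
  have hp1c : (p + 1) ^ c ≤ (p + 1) ^ (c + 1) :=
    Nat.pow_le_pow_right (by omega) (by omega)
  have hpc1 : 1 ≤ (p + 1) ^ (c + 1) := Nat.one_le_pow _ _ (by omega)
  have hp11 : p + 1 ≤ (p + 1) ^ (c + 1) := Nat.le_self_pow (by omega) _
  have hA : (c + 9) ^ c * (p + 1) ^ c ≤ (c + 9) ^ c * (p + 1) ^ (c + 1) := Nat.mul_le_mul_left _ hp1c
  have hB : 8 * p + 15 ≤ 15 * (p + 1) ^ (c + 1) :=
    calc 8 * p + 15 ≤ 15 * (p + 1) := by omega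
      _ ≤ 15 * (p + 1) ^ (c + 1) := Nat.mul_le_mul_left _ hp11
  have h3 : (4 * p + 8 + c) ^ c + 8 * p + 15 ≤ ((c + 9) ^ c + 15) * (p + 1) ^ (c + 1) :=
    calc (4 * p + 8 + c) ^ c + 8 * p + 15 = (4 * p + 8 + c) ^ c + (8 * p + 15) := by ring
      _ ≤ (c + 9) ^ c * (p + 1) ^ (c + 1) + 15 * (p + 1) ^ (c + 1) := Nat.add_le_add (h2.trans hA) hB
      _ = ((c + 9) ^ c + 15) * (p + 1) ^ (c + 1) := by ring
  have h4 : 5 * C₀ * ((4 * p + 8 + c) ^ c + 8 * p + 15) + 1 ≤ K * (p + 1) ^ (c + 1) :=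
    calc 5 * C₀ * ((4 * p + 8 + c) ^ c + 8 * p + 15) + 1
        ≤ 5 * C₀ * (((c + 9) ^ c + 15) * (p + 1) ^ (c + 1)) + (p + 1) ^ (c + 1) :=
          Nat.add_le_add (Nat.mul_le_mul_left _ h3) hpc1
      _ = K * (p + 1) ^ (c + 1) := by rw [hK]; ring
  -- `(p+1)^(c+1) ≤ 2^(c+1) p^(c+1)` for `p ≥ 1`
  have h5 : (p + 1) ^ (c + 1) ≤ 2 ^ (c + 1) * p ^ (c + 1) := by
    rw [← mul_pow]; exact Nat.pow_le_pow_left (by omega) _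
  -- the real inequality `K 2^(c+1) p^(c+1) (1/2)^p < 1`
  have h6 : ((K * 2 ^ (c + 1) : ℕ) : ℝ) * (p : ℝ) ^ (c + 1) < 2 ^ p := by
    have h2p : (0 : ℝ) < 2 ^ p := by positivity
    have := hE
    rw [show (1 / 2 : ℝ) ^ p = 1 / 2 ^ p by rw [one_div, inv_pow, one_div]] at this
    rw [mul_one_div, div_lt_one h2p] at this
    exact this
  have h7 : K * 2 ^ (c + 1) * p ^ (c + 1) < 2 ^ p := by exact_mod_cast h6
  calc 5 * C₀ * ((4 * p + 8 + c) ^ c + 8 * p + 15) + 1 ≤ K * (p + 1) ^ (c + 1) := h4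
    _ ≤ K * (2 ^ (c + 1) * p ^ (c + 1)) := Nat.mul_le_mul_left _ h5
    _ = K * 2 ^ (c + 1) * p ^ (c + 1) := by ring
    _ ≤ 2 ^ p := h7.le

/-! ### The growth condition -/

set_option maxHeartbeats 400000 in
/-- **`hr` for quarter-root rates.**  If `⌊⌊√M⌋^{1/2}⌋ ≤ C₀ · (r M + 1)` for all `M`, then for every `c`, eventually in `n`,
`8·(2^((log₂ n + c)^c) + 1)·(M+1)²·(3/4)^{r M} < 1` whenever `n ≤ 14(M+2)` — the hypothesis `hr` of
`avoidingCounts28_of_pricing`. [folklore] -/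
theorem hr_of_quarterRoot (r : ℕ → ℕ) (C₀ : ℕ) (hrate : ∀ M : ℕ, Nat.sqrt (Nat.sqrt M) ≤ C₀ * (r M + 1)) :
    ∀ c : ℕ, ∃ n₀ : ℕ, ∀ n ≥ n₀, ∀ M : ℕ, n ≤ 14 * (M + 2) →
      (8 * (2 ^ ((Nat.log 2 n + c) ^ c) + 1) * (M + 1) ^ 2 : ℝ) * (3 / 4 : ℝ) ^ (r M) < 1 := by
  intro c
  obtain ⟨p₀, hp₀⟩ := eventually_poly_le_two_pow c C₀
  refine ⟨14 * (2 ^ (4 * (p₀ + 1)) + 2), fun n hn M hM => ?_⟩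
  -- the quarter root `q`, its logarithm `p ≥ p₀ + 1`
  set q := Nat.sqrt (Nat.sqrt M) with hq
  have hMge : 2 ^ (4 * (p₀ + 1)) ≤ M := by omega
  have hq2 : 2 ^ (p₀ + 1) ≤ q := two_pow_le_quarterRoot hMge
  have hq1 : 1 ≤ q := le_trans (Nat.one_le_two_pow) hq2
  set p := Nat.log 2 (q + 1) with hp
  have hp₀p : p₀ + 1 ≤ p := Nat.le_log_of_pow_le (by norm_num) (by omega)
  have hgrow := hp₀ p (by omega)
  -- `q + 1 < 2^(p+1)`, `M + 1 ≤ (q+1)^4`, `n < 2^(4p + 9)`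
  have hq_lt : q + 1 < 2 ^ (p + 1) := Nat.lt_pow_succ_log_self (by norm_num) _
  have hq_ge : 2 ^ p ≤ q + 1 := Nat.pow_log_le_self 2 (by omega)
  have hM1 : M + 1 ≤ (q + 1) ^ 4 := Literature.NumberTheory.LFunctions.SiegelWalfiszLiouville.lt_sqrt_sqrt_add_one_pow M
  have hq4 : (q + 1) ^ 4 < 2 ^ (4 * p + 4) := by
    calc (q + 1) ^ 4 < (2 ^ (p + 1)) ^ 4 := Nat.pow_lt_pow_left hq_lt (by norm_num)
      _ = 2 ^ (4 * p + 4) := by rw [← pow_mul]; ring_nf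
  have hn_lt : n < 2 ^ (4 * p + 9) := by
    calc n ≤ 14 * (M + 2) := hM
      _ ≤ 28 * (q + 1) ^ 4 := by nlinarith
      _ < 32 * 2 ^ (4 * p + 4) := by omega
      _ = 2 ^ (4 * p + 9) := by rw [show (32 : ℕ) = 2 ^ 5 by norm_num, ← pow_add]; ring_nf
  have hlog : Nat.log 2 n ≤ 4 * p + 8 := by
    rcases Nat.eq_zero_or_pos n with h0 | hpos
    · rw [h0, Nat.log_zero_right]; omega
    · have := (Nat.log_lt_iff_lt_pow (by norm_num) hpos.ne').2 hn_lt
      omega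
  -- the exponent count in `ℕ`: `5 + L + 2·(4p+4) ≤ 2 j`
  set L := (Nat.log 2 n + c) ^ c with hL
  have hLle : L ≤ (4 * p + 8 + c) ^ c := Nat.pow_le_pow_left (by omega) c
  set j := q / (5 * C₀) with hj
  have hC₀ : 1 ≤ C₀ := by
    by_contra h0
    push Not at h0
    have hz : C₀ = 0 := by omega
    have hC := hrate M
    rw [hz, zero_mul] at hC
    omega
  have h5C : 0 < 5 * C₀ := by omega
  -- `j ≥ (4p+8+c)^c + 8p + 15`
  have hjge : (4 * p + 8 + c) ^ c + 8 * p + 15 ≤ j := by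
    rw [hj, Nat.le_div_iff_mul_le h5C]
    -- `(…) * (5 C₀) ≤ 2^p - 1 ≤ q`
    have : 5 * C₀ * ((4 * p + 8 + c) ^ c + 8 * p + 15) + 1 ≤ 2 ^ p := hgrow
    have hqp : 2 ^ p ≤ q + 1 := hq_ge
    nlinarith
  have hj1 : 1 ≤ j := le_trans (by omega) hjge
  -- `5 j ≤ r M + 1`
  have hrM : 5 * j ≤ r M + 1 := by
    have h1 : 5 * C₀ * j ≤ q := by rw [hj, mul_comm]; exact Nat.div_mul_le_self _ _
    have h2 : q ≤ C₀ * (r M + 1) := hrate M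
    have : C₀ * (5 * j) ≤ C₀ * (r M + 1) := by nlinarith
    exact Nat.le_of_mul_le_mul_left this (by omega)
  -- the key bound in `ℕ`: `22 · 2^L · (M+1)^2 ≤ 4^j`
  have hkey : 22 * 2 ^ L * (M + 1) ^ 2 ≤ 4 ^ j := by
    have hM2 : (M + 1) ^ 2 ≤ 2 ^ (8 * p + 8) := by
      calc (M + 1) ^ 2 ≤ ((q + 1) ^ 4) ^ 2 := Nat.pow_le_pow_left hM1 2
        _ ≤ (2 ^ (4 * p + 4)) ^ 2 := Nat.pow_le_pow_left hq4.le 2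
        _ = 2 ^ (8 * p + 8) := by rw [← pow_mul]; ring_nf
    have h2L : 2 ^ L ≤ 2 ^ ((4 * p + 8 + c) ^ c) := Nat.pow_le_pow_right (by norm_num) hLle
    calc 22 * 2 ^ L * (M + 1) ^ 2 ≤ 32 * 2 ^ ((4 * p + 8 + c) ^ c) * 2 ^ (8 * p + 8) :=
          Nat.mul_le_mul (Nat.mul_le_mul (by norm_num) h2L) hM2
      _ = 2 ^ (5 + (4 * p + 8 + c) ^ c + (8 * p + 8)) := by
          rw [show (32 : ℕ) = 2 ^ 5 by norm_num, ← pow_add, ← pow_add]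
      _ ≤ 2 ^ (2 * j) := Nat.pow_le_pow_right (by norm_num) (by omega)
      _ = 4 ^ j := by rw [pow_mul]; norm_num
  -- conclude in `ℝ`
  have hkeyR : (22 * 2 ^ L * (M + 1) ^ 2 : ℝ) ≤ 4 ^ j := by exact_mod_cast hkey
  have h34 : (3 / 4 : ℝ) ^ (r M) ≤ (4 / 3) * (1 / 4 : ℝ) ^ j := by
    have h1 : (3 / 4 : ℝ) ^ (r M + 1) ≤ (3 / 4 : ℝ) ^ (5 * j) :=
      pow_le_pow_of_le_one (by norm_num) (by norm_num) hrM
    have h2 := three_quarters_pow_five_mul_le j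
    have h3 : (3 / 4 : ℝ) ^ (r M) = (4 / 3) * (3 / 4 : ℝ) ^ (r M + 1) := by rw [pow_succ]; ring
    rw [h3]
    exact mul_le_mul_of_nonneg_left (h1.trans h2) (by norm_num)
  have h4j : (0 : ℝ) < 4 ^ j := by positivity
  have h14 : (1 / 4 : ℝ) ^ j = 1 / 4 ^ j := by rw [one_div, inv_pow, one_div]
  -- abbreviate `X := 2^L (M+1)^2`, so that `22 X ≤ 4^j`
  set X : ℝ := (2 : ℝ) ^ L * ((M : ℝ) + 1) ^ 2 with hX
  have hX0 : 0 ≤ X := by positivity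
  have hXle : 22 * X ≤ 4 ^ j := by rw [hX]; linarith [hkeyR]
  have h2L1 : (2 : ℝ) ^ L + 1 ≤ 2 * 2 ^ L := by
    have : (1 : ℝ) ≤ 2 ^ L := one_le_pow₀ (by norm_num)
    linarith
  have hM0 : (0 : ℝ) ≤ ((M : ℝ) + 1) ^ 2 := sq_nonneg _
  have hstep1 : (8 * (2 ^ L + 1) * (M + 1) ^ 2 : ℝ) ≤ 16 * X := by
    have h := mul_le_mul_of_nonneg_right h2L1 hM0
    -- `(2^L+1)(M+1)^2 ≤ 2·2^L·(M+1)^2 = 2 X`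
    have h' : ((2 : ℝ) ^ L + 1) * ((M : ℝ) + 1) ^ 2 ≤ 2 * X := by rw [hX]; linarith
    linarith
  have hLdef : (2 : ℝ) ^ ((Nat.log 2 n + c) ^ c) = 2 ^ L := by rw [hL]
  calc (8 * (2 ^ ((Nat.log 2 n + c) ^ c) + 1) * (M + 1) ^ 2 : ℝ) * (3 / 4 : ℝ) ^ (r M)
      = (8 * (2 ^ L + 1) * (M + 1) ^ 2 : ℝ) * (3 / 4 : ℝ) ^ (r M) := by rw [hLdef]
    _ ≤ (16 * X) * ((4 / 3) * (1 / 4 : ℝ) ^ j) :=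
        mul_le_mul hstep1 h34 (pow_nonneg (by norm_num) _) (by linarith)
    _ = (64 / 3) * (X / 4 ^ j) := by rw [h14]; ring
    _ ≤ (64 / 3) * (1 / 22) := by
        apply mul_le_mul_of_nonneg_left _ (by norm_num)
        rw [div_le_div_iff₀ h4j (by norm_num), one_mul]
        linarith
    _ < 1 := by norm_num

end Summit.ValiantsHypothesis.ValiantsHypothesis.Theorems.FifoMatching.NNLinearDegreeCofactorHard.InternalCofactor
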